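import Literature.NumberTheory.Transcendental.LWMeasureSmallness
import HarnessLib

/-!
# The auxiliary polynomials of the Lindemann–Weierstrass measure (Ably 1994, §II, 2e pas) — the composite smallness bound

`Literature/NumberTheory/Transcendental/LWMeasureSmallnessComposite.lean` — proofs only, no named
facts, no definitions. Companion of `LWMeasureSmallness.lean` in the proof of Ably's "Proposition
principale" behind `Ably1994_lindemannWeierstrass_measure`: inequality (6), p. 39, in closed form,
i.e. the four estimates of that file composed —
`Setup.norm_aeval_Qj_le` (the value `Q_{s,h,j}(α, e^y)` against `f^{(s)}(h·y)`), `hermite_pts`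
(Hermite's extrapolation on the points `h·y`, `h ∈ [0,M)ⁿ`), fed with the small `T'`-jets of
`Setup.norm_iteratedDeriv_F_hy_le` ((4)–(5) p. 38) and the maximum-modulus bound `Setup.norm_F_le`
— together with four point-set helpers consumed by the final choice of parameters:
`Setup.hy_mem_pts` (`h·y` is an interpolation point), `Setup.exists_separated` (Liouville's
inequality separates the points `h·y`, `|h_k| < M`, by `c_S/(nM)^{k_S}`), `Setup.ptsRad_le` and
`Setup.lastNorm_y_pos` (the radius and the product bound of `DiazPoints.lean` are explicit).

## References

* [Ably1994] M. Ably, *Une version quantitative du théorème de Lindemann–Weierstrass*, Acta Arith.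
  67 (1994) 29–45, §II 2e pas, (4)–(6) pp. 38–39.
* [NesterenkoPhilippon2001] Yu. V. Nesterenko, P. Philippon (eds.), *Introduction to algebraic
  independence theory*, LNM 1752 (2001), Ch. 14 §3.3 (Liouville's inequality).
-/

noncomputable section

open scoped Nat
open MvPolynomial Finset Complex Metric

namespace Literature.NumberTheory.Transcendental

namespace LWMeasure

open DiazThm1 (muv pts Separated)

namespace Setup

/-! ### The interpolation points `h·y` -/

/-- `h·y ∈ 𝓔(M) = {μ·y ; μ ∈ [0,M)ⁿ}` for `h ∈ [0,M)ⁿ`. [folklore] -/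
theorem hy_mem_pts (S : Setup) {M : ℕ} {h : Fin S.n → ℕ} (hh : ∀ k, h k < M) :
    S.hy h ∈ DiazThm1.pts S.y M :=
  Finset.mem_image.mpr ⟨h, Behrend.mem_box.mpr hh, rfl⟩

/-- Every point of `𝓔(M)` is some `h·y`, `h ∈ [0,M)ⁿ`. [folklore] -/
theorem exists_hy_of_mem_pts (S : Setup) {M : ℕ} {e : ℂ} (he : e ∈ DiazThm1.pts S.y M) :
    ∃ h : Fin S.n → ℕ, (∀ k, h k < M) ∧ e = S.hy h := by
  obtain ⟨h, hh, rfl⟩ := Finset.mem_image.mp he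
  exact ⟨h, Behrend.mem_box.mp hh, rfl⟩

/-- **Separation of the points `h·y`** (Liouville's inequality): there are `0 < c_S ≤ 1` and `k_S`
with `|ν·y| ≥ c_S / (nM)^{k_S}` for every non-zero `ν ∈ ℤⁿ` with `|ν_k| < M` (`M ≥ 1`), i.e.
`Separated y M (c_S/(nM)^{k_S})` (Ably, p. 38: "les points `h·y` sont deux à deux distincts … et
leur distance mutuelle est minorée par une inégalité de Liouville").
[cite: Ably1994, §II 2e pas p. 38] -/
theorem exists_separated (S : Setup) : ∃ (cS : ℝ) (kS : ℕ), 0 < cS ∧ cS ≤ 1 ∧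
    ∀ M : ℕ, 1 ≤ M → DiazThm1.Separated S.y M (cS / ((S.n : ℝ) * M) ^ kS) := by
  obtain ⟨c, hc, k, hk⟩ := exists_lowerBound_linearForm S.y S.alg S.li
  refine ⟨min c 1, k, lt_min hc one_pos, min_le_right _ _, fun M hM ν hν hνM => ?_⟩
  have hnM : 0 < ((S.n : ℝ) * M) ^ k := by
    have h1 : (1 : ℝ) ≤ S.n := by exact_mod_cast S.one_le_n
    have h2 : (1 : ℝ) ≤ M := by exact_mod_cast hM
    positivity
  have hsum : ∑ i, |(ν i : ℝ)| ≤ (S.n : ℝ) * M := by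
    calc ∑ i, |(ν i : ℝ)| ≤ ∑ _i : Fin S.n, (M : ℝ) := by
          refine Finset.sum_le_sum fun i _ => ?_
          have := (hνM i).le
          exact_mod_cast this
      _ = (S.n : ℝ) * M := by simp
  have hkey : c ≤ ((S.n : ℝ) * M) ^ k * ‖∑ i, (ν i : ℂ) * S.y i‖ :=
    (hk ν hν).trans (mul_le_mul_of_nonneg_right
      (pow_le_pow_left₀ (Finset.sum_nonneg fun i _ => abs_nonneg _) hsum k) (norm_nonneg _))
  calc min c 1 / ((S.n : ℝ) * M) ^ k ≤ c / ((S.n : ℝ) * M) ^ k :=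
        div_le_div_of_nonneg_right (min_le_left _ _) hnM.le
    _ ≤ ‖∑ i, (ν i : ℂ) * S.y i‖ := by
        rw [div_le_iff₀ hnM, mul_comm]
        exact hkey

/-- The radius `ρ = max(1, M∑|y_k|)` is at most `M (1 + ∑|y_k|)` (`M ≥ 1`). [folklore] -/
theorem ptsRad_le (S : Setup) {M : ℕ} (hM : 1 ≤ M) :
    ptsRad S.y M ≤ (M : ℝ) * (1 + ∑ k, ‖S.y k‖) := by
  have h1 : (1 : ℝ) ≤ M := by exact_mod_cast hM
  have h2 : 0 ≤ ∑ k, ‖S.y k‖ := Finset.sum_nonneg fun k _ => norm_nonneg _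
  refine max_le ?_ ?_ <;> nlinarith

/-- `ω = min(1, |y_n|/2) > 0`: the last exponent `y_n` is non-zero (`y` is `ℚ`-free, `n ≥ 1`), so
the product bound `Λ₀ = (δ ω^M)^{M^{n-1}}` of `DiazPoints.lean` is positive and explicit.
[folklore] -/
theorem lastNorm_y_pos (S : Setup) : 0 < min 1 (lastNorm S.y / 2) := by
  have h : 0 < lastNorm S.y := by
    have h0 : 0 < S.n := S.one_le_n
    unfold lastNorm
    rw [dif_pos h0]
    exact norm_pos_iff.mpr (S.li.ne_zero _)
  exact lt_min one_pos (by linarith)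

/-! ### (6), p. 39, in closed form -/

/-- **Inequality (6), p. 39, in closed form.** Let `Q_{σ,h'} = 0` for all `σ < T'`, `h' ∈ [0,M)ⁿ`
(Lemme 1), let the points `h'·y` be `δ`-separated (`0 < δ ≤ 1`, `M ≥ 2`), `j` minimal at
`x̃ = (α, z̃)` with `max|z̃ⱼ − e^{yⱼ}| ≤ ε ≤ 1`, and `R_c ≥ ρ + 2`. Then for every `h ∈ [0,M)ⁿ` and
EVERY order `s`,
`|Q_{s,h,j}(α, e^y)| ≤ LD·(2^{n(b−1)}bⁿH n(b−1) A^{n(b−1)} ε)·((L+D)^s K₁(M)^L A^{degM})`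
`  + |c|^L s! (𝓗(ρ+1) + (B + 𝓗(R_c)) ((2ρ+1)/(R_c − ρ))^{T'Mⁿ})`,
`𝓗(t) = Mⁿ T' ε_H (2(t+ρ))^{T'Mⁿ} (2/δ)^{T'} / Λ₀^{T'}`, with the jet bound
`ε_H = LD · 2^{n(b−1)}bⁿH A^{n(b−1)} · (L+D)^{T'} K₁(M)^L degM A^{degM} · ε` of (5) and the
maximum-modulus bound `B = LD · 2^{n(b−1)}bⁿH A^{n(b−1)} · R_c^L e^{DR_c}`: the estimates
`norm_aeval_Qj_le`, `hermite_pts`, `norm_iteratedDeriv_F_hy_le`, `norm_F_le` composed.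
[cite: Ably1994, §II (6) p. 39] -/
theorem norm_aeval_Qj_le_composite (S : Setup) {L D b M T' : ℕ} (hL : 1 ≤ L)
    (p : Unk S.n L D b → ℤ) {H : ℝ} (hH0 : 0 ≤ H) (hH : ∀ w, |(p w : ℝ)| ≤ H) (hM : 2 ≤ M)
    {δ : ℝ} (hsep : DiazThm1.Separated S.y M δ) (hδ : 0 < δ) (hδ1 : δ ≤ 1)
    (hQ : ∀ h : Fin S.n → ℕ, (∀ k, h k < M) → ∀ s < T', S.Q p h s = 0)
    {z : Fin S.n → ℂ} {ε : ℝ} (hε0 : 0 ≤ ε) (hε1 : ε ≤ 1) (hz : ∀ k, ‖z k - S.θ k‖ ≤ ε)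
    {j : Fin (S.n + 1) →₀ ℕ} (hj : S.IsMinIdx p (Fin.cons S.α z) j)
    {Rc : ℝ} (hRc : ptsRad S.y M + 2 ≤ Rc) {h : Fin S.n → ℕ} (hh : ∀ k, h k < M) (s : ℕ) :
    ‖MvPolynomial.aeval (Fin.cons S.α S.θ : Fin (S.n + 1) → ℂ) (S.Qj p h s j)‖ ≤
      (L : ℝ) * D * ((2 ^ (S.n * (b - 1)) * ((b : ℝ) ^ S.n * H) * ((S.n * (b - 1) : ℕ) : ℝ) *
          S.A ^ (S.n * (b - 1)) * ε) * (((L : ℝ) + D) ^ s * S.K₁ M ^ L * S.A ^ S.degM D M)) +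
      |(S.c : ℝ)| ^ L * ((s.factorial : ℝ) *
        (((M ^ S.n : ℕ) : ℝ) * T' *
            ((L : ℝ) * D * ((2 ^ (S.n * (b - 1)) * ((b : ℝ) ^ S.n * H) * S.A ^ (S.n * (b - 1))) *
              (((L : ℝ) + D) ^ T' * S.K₁ M ^ L * (S.degM D M : ℝ) * S.A ^ S.degM D M * ε))) *
            (2 * (ptsRad S.y M + 1 + ptsRad S.y M)) ^ (T' * M ^ S.n) * (2 / δ) ^ T' /
              ptsProd S.y M δ ^ T' +
          ((L : ℝ) * D * (2 ^ (S.n * (b - 1)) * ((b : ℝ) ^ S.n * H) * S.A ^ (S.n * (b - 1))) *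
              Rc ^ L * Real.exp (D * Rc) +
            ((M ^ S.n : ℕ) : ℝ) * T' *
              ((L : ℝ) * D * ((2 ^ (S.n * (b - 1)) * ((b : ℝ) ^ S.n * H) * S.A ^ (S.n * (b - 1))) *
                (((L : ℝ) + D) ^ T' * S.K₁ M ^ L * (S.degM D M : ℝ) * S.A ^ S.degM D M * ε))) *
              (2 * (Rc + ptsRad S.y M)) ^ (T' * M ^ S.n) * (2 / δ) ^ T' / ptsProd S.y M δ ^ T') *
            ((ptsRad S.y M + 1 + ptsRad S.y M) / (Rc - ptsRad S.y M)) ^ (T' * M ^ S.n))) := by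
  -- the coefficients `a_{β,γ} = P_{β,γ,j}(x̃)` and the entire function `f = ∑ a z^β e^{γz}`
  set f : ℂ → ℂ := F fun β γ => aeval (Fin.cons S.α z : Fin (S.n + 1) → ℂ) (S.Pj p (β, γ) j)
    with hf
  have hz1 : ∀ k, ‖z k - S.θ k‖ ≤ 1 := fun k => (hz k).trans hε1
  have hA0 : 0 ≤ S.A := zero_le_one.trans S.one_le_A
  have hK0 : 0 ≤ S.K₁ M := zero_le_one.trans (S.one_le_K₁ M)
  have hLD1 : (1 : ℝ) ≤ (L : ℝ) + D := by
    have h1 : (1 : ℝ) ≤ L := by exact_mod_cast hL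
    have h2 : (0 : ℝ) ≤ D := Nat.cast_nonneg D
    linarith
  have hRc1 : 1 ≤ Rc := by linarith [one_le_ptsRad S.y M]
  -- (5): the `T'`-jets of `f` are small at every interpolation point
  have hsmall : ∀ e ∈ pts S.y M, ∀ σ < T', ‖iteratedDeriv σ f e‖ ≤
      (L : ℝ) * D * ((2 ^ (S.n * (b - 1)) * ((b : ℝ) ^ S.n * H) * S.A ^ (S.n * (b - 1))) *
        (((L : ℝ) + D) ^ T' * S.K₁ M ^ L * (S.degM D M : ℝ) * S.A ^ S.degM D M * ε)) := by
    intro e he σ hσ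
    obtain ⟨h', hh', rfl⟩ := S.exists_hy_of_mem_pts he
    refine (S.norm_iteratedDeriv_F_hy_le p hH0 hH hh' (hQ h' hh' σ hσ) hε0 hε1 hz hj).trans ?_
    have hpow : ((L : ℝ) + D) ^ σ ≤ ((L : ℝ) + D) ^ T' := pow_le_pow_right₀ hLD1 hσ.le
    gcongr
  -- `|f| ≤ B` on `|w| = R_c`
  have hB : ∀ w ∈ sphere (0 : ℂ) Rc, ‖f w‖ ≤
      (L : ℝ) * D * (2 ^ (S.n * (b - 1)) * ((b : ℝ) ^ S.n * H) * S.A ^ (S.n * (b - 1))) *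
        Rc ^ L * Real.exp (D * Rc) := fun w hw =>
    S.norm_F_le p hH0 hH hz1 j hRc1 (mem_sphere_zero_iff_norm.mp hw).le
  -- Hermite's extrapolation at the point `h·y`, order `s`
  have herm := hermite_pts S.one_le_n S.y hM hsep hδ hδ1 (differentiable_F _) T' (by positivity)
    hsmall hRc hB (S.hy_mem_pts hh) s
  -- (6)
  exact (S.norm_aeval_Qj_le p hH0 hH hh s hε0 hε1 hz j).trans
    (add_le_add le_rfl (mul_le_mul_of_nonneg_left herm (pow_nonneg (abs_nonneg _) _)))

end Setup

end LWMeasure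

end Literature.NumberTheory.Transcendental

end
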